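import Mathlib.Geometry.Manifold.Riemannian.Basic
import Mathlib.MeasureTheory.Measure.Hausdorff
import Mathlib.MeasureTheory.Measure.Typeclasses.Finite
import Literature.Geometry.Lorentzian.Volume
import HarnessLib

/-!
# Compact sets have finite Riemannian volume (discharge of `riemannianVolume_lt_top_of_isCompact`)

Companion of `Volume.lean` (the Riemannian volume `riemannianVolume h d = μHE[d]` of the length
metric `riemannianEDist` of a Riemannian metric `h`). We prove the named fact
`riemannianVolume_lt_top_of_isCompact` of that file: on a `C¹` manifold `N` modelled on a
finite-dimensional space `E`, for every `C^n` Riemannian metric `h`, every `d ≥ dim E` and every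
compact `K ⊆ N`, `riemannianVolume h d K < ∞` (`riemannianVolume_lt_top_of_isCompact_holds`).

## Proof

* `exists_riemannianEDist_le_mul_edist_extChartAt`: the *inverse* extended chart at `x` is
  Lipschitz, for the Riemannian distance, on the chart image of a neighbourhood `s` of `x`:
  `d(y, z) ≤ C ‖φ y - φ z‖` for `y, z ∈ s`, `φ = extChartAt I x`. This is the two-point version of
  Mathlib's `eventually_riemannianEDist_le_edist_extChartAt` (which has `y = x`), with the same
  proof: push the segment `[φ y, φ z]` (inside a small ball intersected with `range I`, a convex
  set on which `‖D φ⁻¹‖ < C`, Mathlib's `eventually_enorm_mfderivWithin_symm_extChartAt_lt`) to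
  the manifold and bound the length of the resulting `C¹` path by `C ‖φ y - φ z‖`.
* `hausdorffMeasure_lt_top_of_isBounded`: in a finite-dimensional real normed space, bounded sets
  have finite `d`-dimensional Hausdorff measure for `d ≥ dim` (`μH[dim]` is an additive Haar
  measure, Mathlib's `isAddHaarMeasure_hausdorffMeasure`; `hausdorffMeasure_zero_or_top` for
  `d > dim`).
* `hausdorffMeasure_lt_top_of_isCompact`: Lipschitz maps expand `μH[d]` by at most `C^d`
  (Federer 1969, §2.10.11 = Mathlib's `LipschitzOnWith.hausdorffMeasure_image_le`), so `μH[d]` of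
  the length metric is finite on a neighbourhood of every point, hence on compact sets
  (`IsCompact.measure_lt_top_of_nhdsWithin`).
* `riemannianVolume_lt_top_of_isCompact_holds`: unfold `μHE[d] = c • μH[d]` with `c < ∞`.

## References

* H. Federer, *Geometric Measure Theory*, Springer 1969, §2.10.11 (Hausdorff measure of
  Lipschitz images, `H^m(f A) ≤ Lip(f)^m H^m(A)`; quoted as Proposition 3.5 in F. Morgan,
  *Geometric Measure Theory: A Beginner's Guide*, 5th ed., 2016, Ch. 3), §3.2.46 (Hausdorff
  measure of a Riemannian manifold is the Riemannian volume).
* D. Burago, Yu. Burago, S. Ivanov, *A course in metric geometry*, AMS 2001, §5.1 (charts of a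
  Riemannian manifold are locally bi-Lipschitz for the length metric).
-/

noncomputable section

open Manifold Bundle MeasureTheory Measure Set Filter Metric Module
open scoped ContDiff Topology ENNReal NNReal

namespace Literature.Geometry.Lorentzian

section InverseChartLipschitz

variable {E : Type*} [NormedAddCommGroup E] [NormedSpace ℝ E]
  {H : Type*} [TopologicalSpace H] {I : ModelWithCorners ℝ E H}
  {M : Type*} [TopologicalSpace M] [ChartedSpace H M]
  [RiemannianBundle (fun x : M ↦ TangentSpace I x)]
  [IsManifold I 1 M] [IsContinuousRiemannianBundle E (fun x : M ↦ TangentSpace I x)]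

set_option backward.isDefEq.respectTransparency false in
/-- **Inverse charts are locally Lipschitz for the Riemannian distance.** Around every point
`x` of a `C¹` manifold whose tangent spaces carry a continuously varying inner product there are
a constant `C` and a neighbourhood `s` of `x`, contained in the domain of `φ = extChartAt I x` and
with bounded chart image `φ '' s`, such that `d(y, z) ≤ C · ‖φ(y) - φ(z)‖` for all `y, z ∈ s`,
where `d` is the Riemannian (length) distance `riemannianEDist`. Proof: the segment from `φ y`
to `φ z` lies in a convex set on which the derivative of `φ⁻¹` is bounded by `C`; its image under
`φ⁻¹` is a `C¹` path from `y` to `z` of length `≤ C ‖φ y - φ z‖`. Two-point version of Mathlib's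
`eventually_riemannianEDist_le_edist_extChartAt`; Burago–Burago–Ivanov, *A course in metric
geometry* (2001), §5.1. [folklore] -/
theorem exists_riemannianEDist_le_mul_edist_extChartAt (x : M) :
    ∃ (C : ℝ≥0) (s : Set M), s ∈ 𝓝 x ∧ s ⊆ (extChartAt I x).source ∧
      Bornology.IsBounded (extChartAt I x '' s) ∧
      ∀ y ∈ s, ∀ z ∈ s,
        riemannianEDist I y z ≤ C * edist (extChartAt I x y) (extChartAt I x z) := by
  -- the tangent spaces of the model vector space `E` carry the norm of `E` (Mathlib's
  -- non-instance `normedAddCommGroupTangentSpaceVectorSpace`, activated locally)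
  letI _i₁ : (p : E) → NormedAddCommGroup (TangentSpace 𝓘(ℝ, E) p) := fun p ↦
    normedAddCommGroupTangentSpaceVectorSpace p
  letI _i₂ : (p : E) → NormedSpace ℝ (TangentSpace 𝓘(ℝ, E) p) := fun p ↦
    normedSpaceTangentSpaceVectorSpace p
  -- a bound `C` on the derivative of the inverse extended chart near `extChartAt I x x`
  rcases eventually_enorm_mfderivWithin_symm_extChartAt_lt I x with ⟨C, C_pos, hC⟩
  -- a small convex set around `extChartAt I x x` on which everything is controlled
  obtain ⟨r, r_pos, hr⟩ : ∃ r > 0,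
      ball (extChartAt I x x) r ∩ range I ⊆ (extChartAt I x).target ∩
        {y | ‖mfderiv[range I] (extChartAt I x).symm y‖ₑ < C} :=
    mem_nhdsWithin_iff.1 (inter_mem (extChartAt_target_mem_nhdsWithin x) hC)
  -- pulled back to the manifold, intersected with the chart domain: this is the set `s`
  have A : (extChartAt I x) ⁻¹' (ball (extChartAt I x x) r ∩ range I) ∈ 𝓝 x := by
    apply extChartAt_preimage_mem_nhds_of_mem_nhdsWithin (by simp)
    rw [inter_comm]
    exact inter_mem_nhdsWithin _ (ball_mem_nhds _ r_pos)
  refine ⟨C, (extChartAt I x) ⁻¹' (ball (extChartAt I x x) r ∩ range I) ∩ (chartAt H x).source,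
    inter_mem A (chart_source_mem_nhds H x), ?_, ?_, ?_⟩
  · rw [_root_.extChartAt_source]
    exact inter_subset_right
  · refine (isBounded_ball (x := extChartAt I x x) (r := r)).subset ?_
    rintro _ ⟨y, hy, rfl⟩
    exact hy.1.1
  rintro y ⟨hy, hys⟩ z ⟨hz, hzs⟩
  -- Let `η` be the segment in the extended chart, and `γ` its composition with `φ⁻¹`.
  let η := ContinuousAffineMap.lineMap (R := ℝ) (extChartAt I x y) (extChartAt I x z)
  set γ := (extChartAt I x).symm ∘ η
  -- by convexity, the whole segment is in the controlled set
  have hη : Icc 0 1 ⊆ ⇑η ⁻¹' ((extChartAt I x).target ∩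
        {y | ‖mfderiv[range I] (extChartAt I x).symm y‖ₑ < C}) := by
    simp only [← image_subset_iff, ContinuousAffineMap.coe_lineMap_eq,
     ← segment_eq_image_lineMap, η]
    apply Subset.trans _ hr
    exact ((convex_ball _ _).inter I.convex_range).segment_subset hy hz
  simp only [preimage_inter, subset_inter_iff] at hη
  have η_smooth : CMDiff[Icc 0 1] 1 η := by
    apply ContMDiff.contMDiffOn
    rw [contMDiff_iff_contDiff]
    exact ContinuousAffineMap.contDiff _
  -- the Riemannian distance is bounded by the length of the specific path `γ`
  have hγ : riemannianEDist I y z ≤ pathELength I γ 0 1 := by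
    apply riemannianEDist_le_pathELength _ _ _ zero_le_one
    · exact (contMDiffOn_extChartAt_symm x).comp η_smooth hη.1
    · simp [γ, η, ContinuousAffineMap.coe_lineMap_eq, hys]
    · simp [γ, η, ContinuousAffineMap.coe_lineMap_eq, hzs]
  apply hγ.trans
  -- and the length of `γ` is controlled by the derivative bound on the controlled set
  rw [← lintegral_fderiv_lineMap_eq_edist, pathELength_eq_lintegral_mfderivWithin_Icc,
    ← lintegral_const_mul' _ _ ENNReal.coe_ne_top]
  apply setLIntegral_mono' measurableSet_Icc (fun t ht ↦ ?_)
  have h₁ : mfderiv[Icc 0 1] γ t =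
      (mfderiv[range I] (extChartAt I x).symm (η t)) ∘L (mfderiv[Icc 0 1] η t) := by
    apply mfderivWithin_comp
    · exact mdifferentiableWithinAt_extChartAt_symm (hη.1 ht)
    · exact η_smooth.mdifferentiableOn one_ne_zero t ht
    · exact hη.1.trans (preimage_mono (extChartAt_target_subset_range x))
    · rw [uniqueMDiffWithinAt_iff_uniqueDiffWithinAt]
      exact uniqueDiffOn_Icc zero_lt_one t ht
  have h₂ : mfderiv[Icc 0 1] γ t 1 =
      (mfderiv[range I] (extChartAt I x).symm (η t)) (mfderiv[Icc 0 1] η t 1) := congr($h₁ 1)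
  rw [h₂]
  apply (ContinuousLinearMap.le_opENorm _ _).trans
  gcongr
  · exact (hη.2 ht).le
  · simp only [mfderivWithin_eq_fderivWithin]
    exact le_of_eq rfl

end InverseChartLipschitz

section HausdorffFinite

variable {F : Type*} [NormedAddCommGroup F] [NormedSpace ℝ F] [FiniteDimensional ℝ F]
  [MeasurableSpace F] [BorelSpace F]

/-- **Bounded sets have finite Hausdorff measure in dimensions `≥ dim`.** In a
finite-dimensional real normed space `F`, a bounded set `s` has `μH[d] s < ∞` for every natural
number `d ≥ dim F`: for `d = dim F`, `μH[dim F]` is an additive Haar measure (Mathlib's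
`isAddHaarMeasure_hausdorffMeasure`), finite on the compact set `closure s`; for `d > dim F` the
measure even vanishes (`hausdorffMeasure_zero_or_top`). [folklore] -/
theorem hausdorffMeasure_lt_top_of_isBounded {d : ℕ} (hd : finrank ℝ F ≤ d) {s : Set F}
    (hs : Bornology.IsBounded s) : (μH[d] : Measure F) s < ⊤ := by
  have h₁ : (μH[finrank ℝ F] : Measure F) s < ⊤ :=
    (measure_mono subset_closure).trans_lt hs.isCompact_closure.measure_lt_top
  rcases hd.eq_or_lt with rfl | hlt
  · exact h₁
  · rcases hausdorffMeasure_zero_or_top (X := F)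
      (show ((finrank ℝ F : ℕ) : ℝ) < (d : ℝ) by exact_mod_cast hlt) s with h | h
    · rw [h]
      exact ENNReal.zero_lt_top
    · exact absurd h h₁.ne

end HausdorffFinite

section Compact

variable {E : Type*} [NormedAddCommGroup E] [NormedSpace ℝ E]
  {H : Type*} [TopologicalSpace H] {I : ModelWithCorners ℝ E H}
  {M : Type*} [TopologicalSpace M] [ChartedSpace H M]
  [RiemannianBundle (fun x : M ↦ TangentSpace I x)]
  [IsManifold I 1 M] [IsContinuousRiemannianBundle E (fun x : M ↦ TangentSpace I x)]

/-- **Compact sets have finite Hausdorff measure for the Riemannian length metric.** On a `C¹`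
manifold `M` modelled on the finite-dimensional space `E`, whose tangent spaces carry a
continuously varying inner product, endow `M` with the length (e)metric
`EMetricSpace.ofRiemannianMetric`; then `μH[d] K < ∞` for every compact `K ⊆ M` and every
`d ≥ dim E`. Proof: near each point the inverse extended chart is Lipschitz for the length
distance (`exists_riemannianEDist_le_mul_edist_extChartAt`), Lipschitz maps increase `μH[d]` by
at most the factor `C^d` (Federer 1969, §2.10.11; Mathlib's
`LipschitzOnWith.hausdorffMeasure_image_le`), and bounded subsets of `E` have finite `μH[d]`
(`hausdorffMeasure_lt_top_of_isBounded`); conclude by compactness. Federer, *Geometric Measure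
Theory* (1969), §2.10.11 and §3.2.46. [cite: Federer1969, §2.10.11 and §3.2.46] -/
theorem hausdorffMeasure_lt_top_of_isCompact [T3Space M] [MeasurableSpace M] [BorelSpace M]
    [FiniteDimensional ℝ E] {d : ℕ} (hd : finrank ℝ E ≤ d) {K : Set M} (hK : IsCompact K) :
    letI := EMetricSpace.ofRiemannianMetric I M
    (μH[d] : Measure M) K < ⊤ := by
  letI := EMetricSpace.ofRiemannianMetric I M
  letI : MeasurableSpace E := borel E
  haveI : BorelSpace E := ⟨rfl⟩
  -- the measure is finite on a neighbourhood of every point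
  have hloc : ∀ x ∈ K, (μH[d] : Measure M).FiniteAtFilter (𝓝 x) := by
    intro x _
    obtain ⟨C, s, hs, hsrc, hbdd, hle⟩ :=
      exists_riemannianEDist_le_mul_edist_extChartAt (I := I) x
    refine ⟨s, hs, ?_⟩
    have hL : LipschitzOnWith C (extChartAt I x).symm (extChartAt I x '' s) := by
      rintro _ ⟨y, hy, rfl⟩ _ ⟨z, hz, rfl⟩
      rw [(extChartAt I x).left_inv (hsrc hy), (extChartAt I x).left_inv (hsrc hz)]
      exact hle y hy z hz
    have hsub : s ⊆ (extChartAt I x).symm '' (extChartAt I x '' s) := fun y hy ↦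
      ⟨extChartAt I x y, mem_image_of_mem _ hy, (extChartAt I x).left_inv (hsrc hy)⟩
    calc (μH[d] : Measure M) s
        ≤ (μH[d] : Measure M) ((extChartAt I x).symm '' (extChartAt I x '' s)) :=
          measure_mono hsub
      _ ≤ (C : ℝ≥0∞) ^ (d : ℝ) * (μH[d] : Measure E) (extChartAt I x '' s) :=
          hL.hausdorffMeasure_image_le (Nat.cast_nonneg d)
      _ < ⊤ :=
          ENNReal.mul_lt_top (ENNReal.rpow_lt_top_of_nonneg (Nat.cast_nonneg d)
            ENNReal.coe_ne_top) (hausdorffMeasure_lt_top_of_isBounded hd hbdd)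
  exact hK.measure_lt_top_of_nhdsWithin fun x hx ↦ (hloc x hx).filter_mono nhdsWithin_le_nhds

end Compact

section Volume

variable {E : Type*} [NormedAddCommGroup E] [NormedSpace ℝ E]
  {H : Type*} [TopologicalSpace H] {I : ModelWithCorners ℝ E H} {n : ℕ∞ω}
  {N : Type*} [TopologicalSpace N] [ChartedSpace H N] [IsManifold I 1 N] [T3Space N]
  [MeasurableSpace N] [BorelSpace N]

/-- **Compact sets have finite Riemannian volume** (discharge of the named fact
`riemannianVolume_lt_top_of_isCompact` of `Volume.lean`): for a `C^n` Riemannian metric `h` on a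
`C¹` manifold `N` modelled on the finite-dimensional space `E`, every `d ≥ dim E` and every
compact `K ⊆ N`, `riemannianVolume h d K < ∞`, where `riemannianVolume h d = μHE[d]` is the
Euclidean-normalised `d`-dimensional Hausdorff measure of the length metric of `h` (a finite
multiple of `μH[d]`, `hausdorffMeasure_lt_top_of_isCompact`). Federer, *Geometric Measure Theory*
(1969), §2.10.11 (Lipschitz images) and §3.2.46 (Riemannian manifolds).
[cite: Federer1969, §2.10.11 and §3.2.46] -/
theorem riemannianVolume_lt_top_of_isCompact_holds :
    riemannianVolume_lt_top_of_isCompact (I := I) (n := n) (N := N) := by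
  intro _i h d hd K hK
  letI : RiemannianBundle (fun x : N ↦ TangentSpace I x) :=
    ⟨h.toContinuousRiemannianMetric.toRiemannianMetric⟩
  letI : EMetricSpace N := EMetricSpace.ofRiemannianMetric I N
  show (μHE[d] : Measure N) K < ⊤
  rw [Measure.euclideanHausdorffMeasure_def, Measure.smul_apply, ENNReal.smul_def, smul_eq_mul]
  exact ENNReal.mul_lt_top ENNReal.coe_lt_top (hausdorffMeasure_lt_top_of_isCompact (I := I) hd hK)

end Volume

end Literature.Geometry.Lorentzian

end
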